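import Literature.MathematicalPhysics.QuantumLattice.DysonOrderedIntegral
import Mathlib.Analysis.SpecialFunctions.Exponential
import HarnessLib

/-!
# Ordered integrals of product integrands: `∫_{0≤u₀≤⋯≤u_{k-1}≤t} ∏ f(uᵢ) = (∫₀ᵗ f)^k / k!`,
and the exponential resummation of a scalar Dyson series

Topic `MathematicalPhysics/QuantumLattice`; complement to `DysonOrderedIntegral.lean` (the iterated
simplex integral `orderedIntegral k F t` behind the Dyson series, Bratteli–Robinson I Thm. 3.1.33).
When the integrand is a symmetric product `∏ᵢ f(uᵢ)` of one continuous scalar function — a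
perturbation commuting with the free dynamics, or any scalar weight — the ordered integral is the
`k`-th term of an exponential series:

* `orderedIntegral_prod_eq` — `I_k (u ↦ ∏ᵢ f(uᵢ)) t = (∫₀ᵗ f)^k / k!` for continuous `f : ℝ → ℂ`
  (induction on `k` with the fundamental theorem of calculus:
  `d/du (Φ^{k+1}/(k+1)!) = f Φ^k/k!`, `Φ(u) = ∫₀ᵘ f`);
* `hasSum_mul_orderedIntegral_prod` — hence `Σ_k g^k I_k(∏ f) t = exp(g ∫₀ᵗ f)`: the Dyson series
  of a scalar perturbation resums to an exponential (the `k!` that turns ordered into unordered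
  time integrals; Benfatto–Giuliani–Mastropietro 2006 (2.6)–(2.8) pass freely between the two).

This is also the one-factor template of the shuffle-product identity for ordered integrals used in
linked-cluster arguments. Everything is PROVED; no definition.

## References

* O. Bratteli, D. W. Robinson, *Operator Algebras and Quantum Statistical Mechanics I*, 2nd ed.
  (1987), Thm. 3.1.33 and the remark following it (time-ordered vs. symmetrised integrals).
  [BratteliRobinsonI1987]
* G. Benfatto, A. Giuliani, V. Mastropietro, Ann. Henri Poincaré 7 (2006) 809–898, §2.1
  (2.6)–(2.8). [BenfattoGiulianiMastropietro2006]
-/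

noncomputable section

open MeasureTheory intervalIntegral Finset
open scoped Nat Topology

namespace Literature.MathematicalPhysics.QuantumLattice

/-- Splitting a product over `Fin (k+1)` after `Fin.snoc`: `∏ᵢ f((w, u)ᵢ) = (∏ᵢ f(wᵢ)) · f(u)`. [folklore] -/
theorem prod_fin_snoc {M : Type*} [CommMonoid M] (k : ℕ) (f : ℝ → M) (w : Fin k → ℝ) (u : ℝ) :
    ∏ i : Fin (k + 1), f ((Fin.snoc w u : Fin (k + 1) → ℝ) i) = (∏ i : Fin k, f (w i)) * f u := by
  rw [Fin.prod_univ_castSucc]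
  simp only [Fin.snoc_castSucc, Fin.snoc_last]

/-- A constant right factor comes out of an ordered integral. [folklore] -/
theorem orderedIntegral_mul_const :
    ∀ (j : ℕ) (G : (Fin j → ℝ) → ℂ) (c : ℂ) (τ : ℝ),
      orderedIntegral j (fun w => G w * c) τ = orderedIntegral j G τ * c
  | 0, G, c, τ => rfl
  | j + 1, G, c, τ => by
    rw [orderedIntegral_succ, orderedIntegral_succ]
    simp_rw [orderedIntegral_mul_const j]
    exact intervalIntegral.integral_mul_const c _

/-- **Ordered integral of a product integrand**: for continuous `f : ℝ → ℂ`,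
`∫_{0 ≤ u₀ ≤ ⋯ ≤ u_{k-1} ≤ t} ∏ᵢ f(uᵢ) du = (∫₀ᵗ f)^k / k!`. [cite: BratteliRobinsonI1987, Thm. 3.1.33] -/
theorem orderedIntegral_prod_eq {f : ℝ → ℂ} (hf : Continuous f) :
    ∀ (k : ℕ) (t : ℝ), orderedIntegral k (fun u : Fin k → ℝ => ∏ i, f (u i)) t =
      ((k ! : ℂ)⁻¹) * (∫ s in (0:ℝ)..t, f s) ^ k
  | 0, t => by simp
  | k + 1, t => by
    rw [orderedIntegral_succ]
    -- the inner ordered integrals, by induction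
    have hinner : ∀ u : ℝ, orderedIntegral k (fun w : Fin k → ℝ => ∏ i, f ((Fin.snoc w u : Fin (k + 1) → ℝ) i)) u =
        ((k ! : ℂ)⁻¹ * (∫ s in (0:ℝ)..u, f s) ^ k) * f u := by
      intro u
      have hfun : (fun w : Fin k → ℝ => ∏ i, f ((Fin.snoc w u : Fin (k + 1) → ℝ) i)) =
          fun w => (∏ i : Fin k, f (w i)) * f u := funext fun w => prod_fin_snoc k f w u
      rw [hfun, orderedIntegral_mul_const, orderedIntegral_prod_eq hf k u]
    simp_rw [hinner]
    -- FTC for `Φ(u)^{k+1}/(k+1)!`, `Φ(u) = ∫₀ᵘ f`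
    have hΦ : ∀ u, HasDerivAt (fun v => ∫ s in (0:ℝ)..v, f s) (f u) u :=
      fun u => intervalIntegral.integral_hasDerivAt_right (hf.intervalIntegrable _ _)
        hf.aestronglyMeasurable.stronglyMeasurableAtFilter hf.continuousAt
    have hderiv : ∀ u, HasDerivAt (fun v => (((k + 1)! : ℂ)⁻¹) * (∫ s in (0:ℝ)..v, f s) ^ (k + 1))
        (((k ! : ℂ)⁻¹ * (∫ s in (0:ℝ)..u, f s) ^ k) * f u) u := by
      intro u
      have h := ((hΦ u).pow (k + 1)).const_mul (((k + 1)! : ℂ)⁻¹)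
      refine h.congr_deriv ?_
      rw [Nat.factorial_succ, Nat.add_sub_cancel]
      push_cast
      have hk : ((k : ℂ) + 1) ≠ 0 := by exact_mod_cast Nat.succ_ne_zero k
      have hk! : ((k ! : ℕ) : ℂ) ≠ 0 := by exact_mod_cast Nat.factorial_ne_zero k
      field_simp
    have hcont : Continuous fun u => ((k ! : ℂ)⁻¹ * (∫ s in (0:ℝ)..u, f s) ^ k) * f u :=
      (continuous_const.mul ((continuous_primitive (fun a b => hf.intervalIntegrable a b) 0).pow k)).mul hf
    rw [integral_eq_sub_of_hasDerivAt (fun u _ => hderiv u) (hcont.intervalIntegrable _ _)]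
    simp

/-- **The scalar Dyson series resums to an exponential**: for continuous `f : ℝ → ℂ` and every
complex `g`, `Σ_k g^k ∫_{0≤u₀≤⋯≤u_{k-1}≤t} ∏ f(uᵢ) = exp(g ∫₀ᵗ f)`. [cite: BratteliRobinsonI1987, Thm. 3.1.33] -/
theorem hasSum_mul_orderedIntegral_prod {f : ℝ → ℂ} (hf : Continuous f) (g : ℂ) (t : ℝ) :
    HasSum (fun k : ℕ => g ^ k * orderedIntegral k (fun u : Fin k → ℝ => ∏ i, f (u i)) t)
      (Complex.exp (g * ∫ s in (0:ℝ)..t, f s)) := by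
  have h := NormedSpace.expSeries_div_hasSum_exp (g * ∫ s in (0:ℝ)..t, f s)
  rw [← Complex.exp_eq_exp_ℂ] at h
  have hfun : (fun k : ℕ => g ^ k * orderedIntegral k (fun u : Fin k → ℝ => ∏ i, f (u i)) t) =
      fun k => (g * ∫ s in (0:ℝ)..t, f s) ^ k / k ! := by
    funext k
    rw [orderedIntegral_prod_eq hf, mul_pow]
    ring
  rw [hfun]
  exact h

end Literature.MathematicalPhysics.QuantumLattice

end
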